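import Literature.Algebra.Homology.KInjectiveAdjunctionNaturality
import Mathlib.Algebra.Homology.DerivedCategory.ShortExact
import Mathlib.CategoryTheory.Shift.Adjunction
import HarnessLib

/-!
# The derived adjunction on the K-injective model commutes with connecting morphisms:
# `Φ (δ_{L S} · w) = δ_S · Φ w` for a short exact sequence of complexes `S` with `L S` short exact

Topic `Algebra/Homology`; namespace `Literature.Algebra.Homology`. Pure homological algebra; everything
proved, no named fact. Sequel to `KInjectiveAdjunctionNaturality.lean` (which proves naturality of
`Ψ = shiftedHomLinearEquivOfAdjunction` / `Φ = …OfQuasiIso` in the first variable for CHAIN MAPS, i.e.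
degree-`0` classes). Here: naturality in the first variable for SHIFTED chain maps `m : X' ⟶ X⟦a⟧` of any
degree, and hence for the CONNECTING MORPHISM `δ_S : Q S.X₃ ⟶ (Q S.X₁)⟦1⟧` of a short exact sequence of
cochain complexes (Mathlib `DerivedCategory.triangleOfSESδ`), which is `(Q desc)⁻¹` followed by the
degree-`1` chain map `Cone(S.f) ⟶ S.X₁⟦1⟧`.

* `ShiftedHom.transpose_map_comp` — for an adjunction `G ⊣ H` COMPATIBLE WITH SHIFTS
  (Mathlib `Adjunction.CommShift`) and `m : ShiftedHom X' X a`, `x : ShiftedHom (G X) Y b`: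
  `((m.map G) · x)♭ = m · x♭` (generalises `transpose_mk₀_comp`; Mathlib `ShiftedHom.map_naturality`
  for the unit).
* `commShift_mapHomologicalComplexAdj` — the termwise adjunction `mapHomologicalComplexAdj adj` of an
  adjunction of additive functors is compatible with the shifts of cochain complexes (all comparison
  isomorphisms have identity components).
* `shiftedHomLinearEquivOfAdjunction_map_map_comp`, `shiftedHomLinearEquivOfAdjunctionOfQuasiIso_map_map_comp`
  — **first-variable naturality of `Ψ`, `Φ` for shifted chain maps**:
  `Φ (((m.map L•).map Q) · y) = (m.map Q) · Φ y`.
* `Q_map_descShortComplex_comp_triangleOfSESδ`, `Q_map_map_descShortComplex_comp_triangleOfSESδ` — the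
  connecting morphism unfolded: `Q(desc_S) ≫ δ_S = (∂_S).map Q` and, for `S' = S.map L•` short exact,
  `Q(L• desc_S) ≫ δ_{S'} = ((∂_S).map L•).map Q`, `∂_S : Cone(S.f) ⟶ S.X₁⟦1⟧` the third side of the cone
  triangle (Mathlib `descShortComplex_triangleOfSESδ`, `mapHomologicalComplexIso_hom_descShortComplex`,
  `mappingCone.map_δ`); `quasiIso_map_descShortComplex` — `L• desc_S` is a quasi-isomorphism when `S'` is
  short exact.
* **`shiftedHomLinearEquivOfAdjunctionOfQuasiIso_triangleOfSESδ_comp`** — for `L ⊣ R` additive with `L`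
  mono-preserving, `E → I` an injective resolution with `R`-acyclic comparison, `S` short exact in
  `CochainComplex C ℤ` with `S.map L•` short exact, and `w : Q(L S.X₁) ⟶ (Q E)⟦n⟧`:
  `Φ_{S.X₃} (δ_{S.map L•} · w) = δ_S · Φ_{S.X₁} (w)` — the node law (δ) `AdjTriangleOfSESδComp` of Road №4
  of the Hodge atlas (crux stmt-HodgeConjecture-26512) in generic form.

## References
* J. Lipman, *Notes on derived functors and Grothendieck duality*, LNM 1960 (2009), Prop. 3.2.3,
  Cor. 3.2.4. [Lipman2009]
* C. A. Weibel, *An introduction to homological algebra* (1994), §10.2 (10.2.7–10.2.8: the connecting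
  morphism as the cone triangle) and §10.4 (Cor. 10.4.7). [Weibel1994]
* U. Görtz, T. Wedhorn, *Algebraic Geometry II* (2023), Prop. F.191 and Rem. F.190. [GortzWedhorn2023]
-/

noncomputable section

open CategoryTheory CategoryTheory.Limits CategoryTheory.Category

namespace Literature.Algebra.Homology

universe w w' v v' u u'

/-! ### Transpose of shifted Homs along an adjunction compatible with shifts -/

section Transpose

variable {C : Type u} [Category.{v} C] {D : Type u'} [Category.{v'} D] {A : Type*} [AddMonoid A]
  [HasShift C A] [HasShift D A] {G : C ⥤ D} {H : D ⥤ C} (adj : G ⊣ H) [G.CommShift A] [H.CommShift A]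
  [adj.CommShift A]

/-- **Naturality of the transpose in the first variable for SHIFTED morphisms** `m : X' ⟶ X⟦a⟧`:
`((m.map G) · x)♭ = m · x♭`, for an adjunction compatible with the shifts (the unit commutes with the
shifts: Mathlib `ShiftedHom.map_naturality`). [cite: Weibel1994, §10.4 (Cor. 10.4.7)] -/
theorem ShiftedHom.transpose_map_comp {X X' : C} {Y : D} {a b c : A} (m : ShiftedHom X' X a)
    (x : ShiftedHom (G.obj X) Y b) (h : b + a = c) :
    ShiftedHom.transpose adj ((m.map G).comp x h) = m.comp (ShiftedHom.transpose adj x) h := by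
  rw [ShiftedHom.transpose_eq, ShiftedHom.transpose_eq, ShiftedHom.map_comp, ← ShiftedHom.comp_map]
  -- the unit commutes with the shifts: `m ≫ (η_X)⟦a⟧' = η_{X'} ≫ m.map (G ⋙ H)` (`ShiftedHom.map_naturality`)
  have hnat := ShiftedHom.map_naturality m adj.unit (F := 𝟭 C) (G := G ⋙ H)
  rw [ShiftedHom.id_map, ShiftedHom.comp_mk₀, ShiftedHom.mk₀_comp] at hnat
  calc (adj.unit.app X' : X' ⟶ H.obj (G.obj X')) ≫ (m.map (G ⋙ H)).comp (x.map H) h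
      = ShiftedHom.comp ((adj.unit.app X' : X' ⟶ H.obj (G.obj X')) ≫ m.map (G ⋙ H) :
          ShiftedHom X' (H.obj (G.obj X)) a) (x.map H) h := (ShiftedHom.precomp_comp _ _ _ h).symm
    _ = ShiftedHom.comp (m ≫ (adj.unit.app X)⟦a⟧' : ShiftedHom X' (H.obj (G.obj X)) a) (x.map H) h :=
          congrArg (fun t : ShiftedHom X' (H.obj (G.obj X)) a => ShiftedHom.comp t (x.map H) h) hnat.symm
    _ = m.comp ((adj.unit.app X : X ⟶ H.obj (G.obj X)) ≫ x.map H) h := ShiftedHom.comp_shift_comp _ _ _ h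

end Transpose

/-! ### The termwise adjunction on cochain complexes is compatible with the shifts -/

section CochainShift

variable {V : Type u} [Category.{v} V] [Preadditive V] {W : Type u'} [Category.{v'} W] [Preadditive W]
  {L : V ⥤ W} {R : W ⥤ V} (adj : L ⊣ R) [L.Additive] [R.Additive]

/-- **The termwise adjunction `L• ⊣ R•` on cochain complexes is compatible with the shifts** (Mathlib's
`CommShift` structures on `Functor.mapHomologicalComplex`, whose comparison isomorphisms have identity
components): the unit `K ⟶ R•L•K` in degree `i` of `K⟦a⟧` is the unit of `K` in degree `i + a`.
[cite: Weibel1994, §10.4] -/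
theorem commShift_mapHomologicalComplexAdj :
    (mapHomologicalComplexAdj adj (ComplexShape.up ℤ)).CommShift ℤ := by
  refine Adjunction.CommShift.mk' _ _ ⟨fun a => ?_⟩
  ext K i
  simp only [Functor.id_obj, NatTrans.comp_app, Functor.whiskerRight_app,
    Functor.whiskerLeft_app, Functor.commShiftIso_id_hom_app, Functor.commShiftIso_comp_hom_app,
    HomologicalComplex.comp_f, CochainComplex.shiftFunctor_map_f',
    Functor.mapHomologicalComplex_map_f, Functor.mapHomologicalComplex_commShiftIso_hom_app_f,
    mapHomologicalComplexAdj_unit_app_f]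
  change 𝟙 (K.X (i + a)) ≫ adj.unit.app (K.X (i + a)) =
    adj.unit.app (K.X (i + a)) ≫ R.map (𝟙 (L.obj (K.X (i + a)))) ≫ 𝟙 (R.obj (L.obj (K.X (i + a))))
  simp only [Category.id_comp]
  erw [R.map_id, Category.id_comp, Category.comp_id]

end CochainShift

/-! ### First-variable naturality of `Ψ` and `Φ` for shifted chain maps -/

section KInjective

variable {𝕜 : Type*} [Ring 𝕜] {C : Type u} [Category.{v} C] [Abelian C] [Linear 𝕜 C]
  {D : Type u'} [Category.{v'} D] [Abelian D] [Linear 𝕜 D]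
  [HasDerivedCategory.{w} C] [HasDerivedCategory.{w'} D]
  {L : C ⥤ D} {R : D ⥤ C} (adj : L ⊣ R) [L.Additive] [R.Additive] [R.Linear 𝕜] [L.PreservesMonomorphisms]

/-- **`Ψ (((m.map L•).map Q) · y) = (m.map Q) · Ψ y`** for a shifted chain map `m : X' ⟶ X⟦a⟧` and a derived
class `y : Q(L• X) ⟶ (Q J)⟦k⟧`, `J` bounded-below injective: every `y` is a chain-level `ỹ.map Q`
(`exists_map_Q_eq`), `Ψ` is the transpose read through `Q` (`shiftedHomLinearEquivOfAdjunction_map`), and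
the transpose is natural for shifted morphisms (`ShiftedHom.transpose_map_comp`).
[cite: Lipman2009, Prop. 3.2.3] [cite: Weibel1994, §10.4] -/
theorem shiftedHomLinearEquivOfAdjunction_map_map_comp {X X' : CochainComplex C ℤ} {a : ℤ}
    (m : ShiftedHom X' X a) (J : CochainComplex D ℤ) (aJ : ℤ) [J.IsStrictlyGE aJ] [∀ n, Injective (J.X n)]
    {k c : ℤ} (h : k + a = c)
    (y : ShiftedHom (DerivedCategory.Q.obj ((L.mapHomologicalComplex (ComplexShape.up ℤ)).obj X))
      (DerivedCategory.Q.obj J) k) :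
    shiftedHomLinearEquivOfAdjunction (𝕜 := 𝕜) adj X' J aJ c
        (((m.map (L.mapHomologicalComplex (ComplexShape.up ℤ))).map DerivedCategory.Q).comp y h) =
      (m.map DerivedCategory.Q).comp (shiftedHomLinearEquivOfAdjunction (𝕜 := 𝕜) adj X J aJ k y) h := by
  haveI := commShift_mapHomologicalComplexAdj adj
  obtain ⟨y, rfl⟩ := exists_map_Q_eq _ J aJ k y
  rw [← ShiftedHom.map_comp, shiftedHomLinearEquivOfAdjunction_map, shiftedHomLinearEquivOfAdjunction_map,
    ShiftedHom.transpose_map_comp, ShiftedHom.map_comp]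

/-- **`Φ (((m.map L•).map Q) · y) = (m.map Q) · Φ y`** — the same for the resolution-transported equivalence
`Φ = shiftedHomLinearEquivOfAdjunctionOfQuasiIso` (resolution `ι : E ⟶ I`, `R ι` a quasi-isomorphism).
[cite: Lipman2009, Prop. 3.2.3 and Cor. 3.2.4] -/
theorem shiftedHomLinearEquivOfAdjunctionOfQuasiIso_map_map_comp {X X' : CochainComplex C ℤ} {a : ℤ}
    (m : ShiftedHom X' X a) {E I : CochainComplex D ℤ} (ι : E ⟶ I) [QuasiIso ι] (aI : ℤ) [I.IsStrictlyGE aI]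
    [∀ n, Injective (I.X n)] (hR : QuasiIso ((R.mapHomologicalComplex (ComplexShape.up ℤ)).map ι))
    {k c : ℤ} (h : k + a = c)
    (y : ShiftedHom (DerivedCategory.Q.obj ((L.mapHomologicalComplex (ComplexShape.up ℤ)).obj X))
      (DerivedCategory.Q.obj E) k) :
    shiftedHomLinearEquivOfAdjunctionOfQuasiIso (𝕜 := 𝕜) adj X' ι aI hR c
        (((m.map (L.mapHomologicalComplex (ComplexShape.up ℤ))).map DerivedCategory.Q).comp y h) =
      (m.map DerivedCategory.Q).comp (shiftedHomLinearEquivOfAdjunctionOfQuasiIso (𝕜 := 𝕜) adj X ι aI hR k y) h := by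
  rw [shiftedHomLinearEquivOfAdjunctionOfQuasiIso_eq, shiftedHomLinearEquivOfAdjunctionOfQuasiIso_eq,
    ← ShiftedHom.comp_postcomp, shiftedHomLinearEquivOfAdjunction_map_map_comp, ShiftedHom.comp_postcomp]

/-! ### The connecting morphism of a short exact sequence of complexes, unfolded -/

omit [Linear 𝕜 C] [HasDerivedCategory.{w} C] in
/-- **`∂_f : Cone(f) ⟶ K⟦1⟧`** — the third side of the cone triangle of a chain map `f : K ⟶ L` (Mathlib
`CochainComplex.mappingCone.triangle`), as a degree-`1` shifted Hom. [cite: Weibel1994, §10.2 (10.2.7)] -/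
abbrev coneδ {K L : CochainComplex C ℤ} (f : K ⟶ L) : ShiftedHom (CochainComplex.mappingCone f) K (1 : ℤ) :=
  (CochainComplex.mappingCone.triangle f).mor₃

omit [Linear 𝕜 C] in
/-- **`Q(desc_S) ≫ δ_S = (∂_S).map Q`**: Mathlib's connecting morphism `triangleOfSESδ` of a short exact
sequence of cochain complexes is the inverse of the quasi-isomorphism `Q(desc_S) : Q(Cone S.f) ⟶ Q S.X₃`
followed by the image of the degree-`1` chain map `∂_S : Cone(S.f) ⟶ S.X₁⟦1⟧`. [cite: Weibel1994, §10.2 (10.2.7–10.2.8)] -/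
theorem Q_map_descShortComplex_comp_triangleOfSESδ {S : ShortComplex (CochainComplex C ℤ)}
    (hS : S.ShortExact) :
    DerivedCategory.Q.map (CochainComplex.mappingCone.descShortComplex S) ≫ DerivedCategory.triangleOfSESδ hS =
      (coneδ S.f).map DerivedCategory.Q :=
  DerivedCategory.descShortComplex_triangleOfSESδ hS

omit [R.Linear 𝕜] [L.PreservesMonomorphisms] [Linear 𝕜 C] [Linear 𝕜 D] [HasDerivedCategory.{w} C]
  [HasDerivedCategory.{w'} D] [R.Additive] in
/-- `L•(desc_S)` is a quasi-isomorphism when `S.map L•` is short exact (it is `Cone(L• S.f) ≅ L•Cone(S.f)`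
followed by `desc_{S.map L•}`). [cite: Weibel1994, §10.2] -/
theorem quasiIso_map_descShortComplex {S : ShortComplex (CochainComplex C ℤ)}
    (hS' : (S.map (L.mapHomologicalComplex (ComplexShape.up ℤ))).ShortExact) :
    QuasiIso ((L.mapHomologicalComplex (ComplexShape.up ℤ)).map (CochainComplex.mappingCone.descShortComplex S)) := by
  rw [← CochainComplex.mappingCone.mapHomologicalComplexIso_hom_descShortComplex]
  haveI := CochainComplex.mappingCone.quasiIso_descShortComplex hS'
  exact (quasiIso_iff_comp_left _ _).mpr this

omit [R.Linear 𝕜] [L.PreservesMonomorphisms] [Linear 𝕜 C] [Linear 𝕜 D] [HasDerivedCategory.{w} C]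
  [R.Additive] in
/-- **`Q(L• desc_S) ≫ δ_{S.map L•} = ((∂_S).map L•).map Q`** — the connecting morphism of the image sequence
`S.map L•` (assumed short exact) is carried by the image of the degree-`1` chain map `∂_S : Cone(S.f) ⟶ S.X₁⟦1⟧`
(Mathlib `mapHomologicalComplexIso_hom_descShortComplex`, `mappingCone.map_δ`). [cite: Weibel1994, §10.2] -/
theorem Q_map_map_descShortComplex_comp_triangleOfSESδ {S : ShortComplex (CochainComplex C ℤ)}
    (hS' : (S.map (L.mapHomologicalComplex (ComplexShape.up ℤ))).ShortExact) :
    DerivedCategory.Q.map ((L.mapHomologicalComplex (ComplexShape.up ℤ)).map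
        (CochainComplex.mappingCone.descShortComplex S)) ≫
      (DerivedCategory.triangleOfSESδ hS' :
        ShiftedHom (DerivedCategory.Q.obj ((L.mapHomologicalComplex (ComplexShape.up ℤ)).obj S.X₃))
          (DerivedCategory.Q.obj ((L.mapHomologicalComplex (ComplexShape.up ℤ)).obj S.X₁)) (1 : ℤ)) =
      ((coneδ S.f).map (L.mapHomologicalComplex (ComplexShape.up ℤ))).map DerivedCategory.Q := by
  have h := DerivedCategory.descShortComplex_triangleOfSESδ hS'
  have he := CochainComplex.mappingCone.mapHomologicalComplexIso_hom_descShortComplex L S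
  have hδ := CochainComplex.mappingCone.map_δ S.f L
  -- `Q(L desc_S) ≫ δ' = Q(e.hom) ≫ Q(desc') ≫ δ' = Q(e.hom) ≫ Q(∂') ≫ cs = Q(L ∂ ≫ cs_L) ≫ cs`
  erw [← he, Functor.map_comp, Category.assoc, h, ← DerivedCategory.Q.map_comp_assoc, ← hδ]
  rfl

/-! ### The law (δ): `Φ` commutes with connecting morphisms -/

/-- **The derived adjunction commutes with connecting morphisms** (node law (δ) `AdjTriangleOfSESδComp` of
Road №4 in generic form): for `L ⊣ R` additive with `L` preserving monomorphisms, an injective resolution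
`ι : E ⟶ I` with `R ι` a quasi-isomorphism, a short exact sequence `S` of cochain complexes with `S.map L•`
short exact, `w : Q(L• S.X₁) ⟶ (Q E)⟦n⟧` and `n + 1 = m`:
**`Φ_{S.X₃} (δ_{S.map L•} · w) = δ_S · Φ_{S.X₁} (w)`**. Proof: `δ = (Q desc)⁻¹ ≫ ∂.map Q`; naturality of `Φ`
for the chain map `desc` (`…OfQuasiIso_mk₀_comp`) and for the shifted chain map `∂`
(`…OfQuasiIso_map_map_comp`), and invertibility of `Q(desc)`.
[cite: Lipman2009, Prop. 3.2.3 and Cor. 3.2.4] [cite: Weibel1994, §10.2 and Cor. 10.4.7] [cite: GortzWedhorn2023, Prop. F.191] -/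
theorem shiftedHomLinearEquivOfAdjunctionOfQuasiIso_triangleOfSESδ_comp {E I : CochainComplex D ℤ}
    (ι : E ⟶ I) [QuasiIso ι] (aI : ℤ) [I.IsStrictlyGE aI] [∀ n, Injective (I.X n)]
    (hR : QuasiIso ((R.mapHomologicalComplex (ComplexShape.up ℤ)).map ι))
    {S : ShortComplex (CochainComplex C ℤ)} (hS : S.ShortExact)
    (hS' : (S.map (L.mapHomologicalComplex (ComplexShape.up ℤ))).ShortExact) {n m : ℤ} (h : n + 1 = m)
    (w : ShiftedHom (DerivedCategory.Q.obj ((L.mapHomologicalComplex (ComplexShape.up ℤ)).obj S.X₁))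
      (DerivedCategory.Q.obj E) n) :
    shiftedHomLinearEquivOfAdjunctionOfQuasiIso (𝕜 := 𝕜) adj S.X₃ ι aI hR m
        (ShiftedHom.comp (DerivedCategory.triangleOfSESδ hS' :
          ShiftedHom (DerivedCategory.Q.obj ((L.mapHomologicalComplex (ComplexShape.up ℤ)).obj S.X₃))
            (DerivedCategory.Q.obj ((L.mapHomologicalComplex (ComplexShape.up ℤ)).obj S.X₁)) (1 : ℤ)) w h) =
      ShiftedHom.comp (DerivedCategory.triangleOfSESδ hS :
          ShiftedHom (DerivedCategory.Q.obj S.X₃) (DerivedCategory.Q.obj S.X₁) (1 : ℤ))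
        (shiftedHomLinearEquivOfAdjunctionOfQuasiIso (𝕜 := 𝕜) adj S.X₁ ι aI hR n w) h := by
  -- normalise the type of `δ'` (its source/target are `Q(L• S.Xᵢ)` definitionally)
  set δ' : ShiftedHom (DerivedCategory.Q.obj ((L.mapHomologicalComplex (ComplexShape.up ℤ)).obj S.X₃))
      (DerivedCategory.Q.obj ((L.mapHomologicalComplex (ComplexShape.up ℤ)).obj S.X₁)) (1 : ℤ) :=
    DerivedCategory.triangleOfSESδ hS' with hδ'def
  haveI := CochainComplex.mappingCone.quasiIso_descShortComplex hS
  haveI : IsIso (DerivedCategory.Q.map (CochainComplex.mappingCone.descShortComplex S)) := by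
    rw [DerivedCategory.isIso_Q_map_iff_quasiIso]; infer_instance
  haveI : QuasiIso ((L.mapHomologicalComplex (ComplexShape.up ℤ)).map
      (CochainComplex.mappingCone.descShortComplex S)) := quasiIso_map_descShortComplex hS'
  haveI : IsIso (DerivedCategory.Q.map ((L.mapHomologicalComplex (ComplexShape.up ℤ)).map
      (CochainComplex.mappingCone.descShortComplex S))) := by
    rw [DerivedCategory.isIso_Q_map_iff_quasiIso]; infer_instance
  -- `δ_S = (Q desc)⁻¹ ≫ ∂.map Q` and `Q(L desc) ≫ δ' = (∂.map L•).map Q`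
  have hδ : (DerivedCategory.triangleOfSESδ hS : ShiftedHom (DerivedCategory.Q.obj S.X₃)
      (DerivedCategory.Q.obj S.X₁) (1 : ℤ)) =
      inv (DerivedCategory.Q.map (CochainComplex.mappingCone.descShortComplex S)) ≫
        (coneδ S.f).map DerivedCategory.Q := by
    rw [eq_comm, IsIso.inv_comp_eq]
    exact (Q_map_descShortComplex_comp_triangleOfSESδ hS).symm
  have hδ' : (DerivedCategory.Q.map ((L.mapHomologicalComplex (ComplexShape.up ℤ)).map
      (CochainComplex.mappingCone.descShortComplex S)) ≫ δ' :
        ShiftedHom (DerivedCategory.Q.obj ((L.mapHomologicalComplex (ComplexShape.up ℤ)).obj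
          (CochainComplex.mappingCone S.f)))
          (DerivedCategory.Q.obj ((L.mapHomologicalComplex (ComplexShape.up ℤ)).obj S.X₁)) (1 : ℤ)) =
      ((coneδ S.f).map (L.mapHomologicalComplex (ComplexShape.up ℤ))).map DerivedCategory.Q :=
    Q_map_map_descShortComplex_comp_triangleOfSESδ (L := L) hS'
  -- naturality for the chain map `desc` …
  have h1 := shiftedHomLinearEquivOfAdjunctionOfQuasiIso_mk₀_comp (𝕜 := 𝕜) adj
    (CochainComplex.mappingCone.descShortComplex S) ι aI hR m (δ'.comp w h)
  rw [ShiftedHom.mk₀_comp, ShiftedHom.mk₀_comp, ← ShiftedHom.precomp_comp, hδ',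
    -- … and for the shifted chain map `∂`
    shiftedHomLinearEquivOfAdjunctionOfQuasiIso_map_map_comp] at h1
  -- cancel `Q desc`
  rw [hδ, ShiftedHom.precomp_comp, h1, IsIso.inv_hom_id_assoc]
  rfl

end KInjective

end Literature.Algebra.Homology

end
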